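import Summits.QuantumFields.YangMills.Theorems.BalabanUVNodesN15AtRRec13CoPHOn
import Summits.QuantumFields.YangMills.Theorems.BalabanUVNodesN15FullPropagatorGenuineN15At
import Summits.QuantumFields.YangMills.Theorems.BalabanUVNodesN15AtRateRecord12V1
import Summits.QuantumFields.YangMills.Theorems.BalabanUVNodesRateReadingOfRecord13CoPH

/-!
# Route «BalabanUVNodes», cluster K4 «SpineRates» — node N15 = NE2 AT THE STAGE-13 v1.7 `CoPH` READING OF RECORD `readingOfRecord₁₃CoPH w1 ℓ₃ ne2 ne1` (dag-n22-e 6″ᶜᵒᵖᴴ)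
# AND THE GENUINE `U ≡ 1` FAMILY AT BOTH `CoPH` HOMES: the producer faces for n27-c's displayed `h15` — any residual layer `ne2` (θ-form ∕ pin, plain and `Rg`-guarded),
# the LG-vector knit reading (hypothesis-free), the GENUINE reading (Bałaban's own `U ≡ 1` objects: hypothesis-free up to the weight window, `Populated`), the
# `V′₁(A′)`-live reading (operator layer by dag-n15-c's theorem, site ∕ unit displayed)

Cell `pub-ymgap`, seat `pub-ymgap-dag-n15-a` (-a KNIT-BY-NAME seat of node N15; HUMAN RULING D-0062; chair R424 venue), generation 14, part 75 (THEOREMS ONLY, 0 `def`,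
0 `sorry`).  `bears_on: R4∕N15 · K3⁷ SpineGivenEndpointR13SepCoPH (stmt-QuantumFields-20544, plan rev 24∕25; dag-lead WORDS-143)`.  Filed `--kind proof --supports
stmt-QuantumFields-20544 --as helper` — COUNT-NEUTRAL.  Imports part 74b `…N15AtRRec13CoPHOn` (the two CoPH homes, parts 74∕74b), part 73 `…N15FullPropagatorGenuineN15At`
(the genuine family `fullGObjects`, `n15At_fullGObjects`, `s_N15_of_admits_fullG(_family)`), part 32 `…N15AtRateRecord12V1` (the stage-generic `V′₁(A′)` face
`s_N15_of_admits_v1G`, `populated_v1GObjects`) and dag-n22-e's 6″ᶜᵒᵖᴴ `…RateReadingOfRecord13CoPH` (p542539: `readingOfRecord₁₃CoPH`, `readingOfRecord₁₃CoPH_ne2`,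
`readingOfRecord₁₃CoPH_populated_iff`, `s_N15_readingOfRecord₁₃CoPH_iff`).

WHY.  The K3⁷ composer reads N15 at `RRec₁₃CoPH (readingOfRecord₁₃CoPH w1 ℓ₃ ne2 ne1)` (dag-n27-c XLᶜᵒᵖᴴ `…N27AtReadingOfRecord13CoPH`, leaf B) and at
`RRec₁₃CoPHOn (readingOfRecord₁₃CoPH w1 ℓ₃ ne2 ne1) Rg` (XLI∕XLIIᶜᵒᵖᴴ), N15's residual layer being the reading's FREE argument `ne2 : (F : T4Family) → Stage13HParams F N →
(ℕ → ℝ) → List (ULoop F) → ℕ → NE2Objects₁₁` — displayed as `h15`, the one rate slot with no producer face at this edition (`FIELD-TABLE-R13CoPH.md`).  This file is the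
v1.7 image of part 38 `…N15AtRateReadingOfRecord13` (p497486) PLUS the guarded forms PLUS the GENUINE family (new at g14, part 73).

CONTENTS.  §1 ANY RESIDUAL LAYER: `s_N15_readingOfRecord₁₃CoPH_of_forall` (θ-form in `ne2`), `…_of_pin`, `s_N15_readingOfRecord₁₃CoPHOn_iff` (the guarded dictionary 6″ omits for
N15), `s_N15_readingOfRecord₁₃CoPHOn_of_forall_regime`, `…On_of_pin`, `s_N15_readingOfRecord₁₃CoPH_homes_of_forall` (both homes at once), `n15At_of_s_N15_readingOfRecord₁₃CoPH`
(read-out).  §2 THE LG-VECTOR KNIT READING (model, hypothesis-free): `s_N15_readingOfRecord₁₃CoPH_homes_of_knit_family` (both homes), `s_N15_readingOfRecord₁₃CoPH_of_knit_family`,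
`s_N15_readingOfRecord₁₃CoPHOn_of_knit_family`, `populated_readingOfRecord₁₃CoPH_of_knit_family`.
§3 ★ THE GENUINE `U ≡ 1` READING — BAŁABAN's OWN OBJECTS ON THE DATUM FAMILY's TORI: `s_N15_rRec₁₃CoPH_of_fullGReading` ∕ `s_N15_rRec₁₃CoPHOn_of_fullGReading` (any reading `𝔯`
valued in `fullGObjects 3 F.hL b a_S (a F) ν μ c₃₅ p` on the admissible tuples, weight in the window ⇒ the stub at both homes, NO estimate displayed),
★★ `s_N15_readingOfRecord₁₃CoPH_homes_of_fullG_family` (both homes), `s_N15_readingOfRecord₁₃CoPH_of_fullG_family`, `s_N15_readingOfRecord₁₃CoPHOn_of_fullG_family`,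
`populated_readingOfRecord₁₃CoPH_of_fullG_family`, `exists_reading_s_N15_rRec₁₃CoPH_fullG_family` (SOME Stage-13 reading — genuine objects, populated — has the stub at
both homes outright), ★★ `exists_ne2_s_N15_readingOfRecord₁₃CoPH_fullG` (SOME residual
layer — the genuine one at a window weight — closes `h15` at the reading of record AT BOTH HOMES for every `w1 ℓ₃ ne1`, populated everywhere: decided, non-degenerate,
GENUINE objects).  §4 THE `V′₁(A′)`-LIVE READING (dag-n15-c (V4)): `s_N15_readingOfRecord₁₃CoPH_of_v1G`, `populated_readingOfRecord₁₃CoPH_of_v1G` (operator layer by the producer's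
theorem, background LIVE; site ∕ unit layers DISPLAYED — no producer with the background live).

HONEST FRAMING.  Kernel bookkeeping BY NAME; no estimate is proved here.  The residual layer `ne2` of the reading of record is NOT pinned by Node 00 (the readings in
§2–§4 are readings this file NAMES, not the objects of record: Node 00's [B9] operator layer of record is residual); §3's genuine family is the `U ≡ 1` (A = 0) content
for Bałaban's own linear objects on the one-point background carrier (the «+» inert; weight window; sup-block rate artefacts), NOT the multiscale `G(U)`; §4's
background is dag-n15-c's linearised first-order species.  NE2⁺ is NOT PRINTED beyond King's scalar template and NOT PROVED for general `U`; no Stage-13 datum key is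
claimed inhabited (K0⁷ `Record13SepCoPHInhabited` OPEN — where none exists every `S_N15` here is vacuous); **N15 ∕ NE2 is NOT discharged** (typed 28∕28 · discharged
5∕27 of record unchanged); count-neutral; one finite four-torus programme at fixed `ε` — NOT ℝ⁴, NOT infinite volume, NOT OS, NOT a mass gap, NOT Clay.  Restate-immune
(no Theses import).  No decl below carries a cite tag.
-/

set_option autoImplicit false

noncomputable section
namespace Summit.QuantumFields.YangMills.BalabanUVNodes.N15.AtReadingOfRecord13CoPH

open Literature.MathematicalPhysics.QuantumFieldTheory.Balaban1983to89
open Literature.MathematicalPhysics.QuantumFieldTheory.Balaban1983to89.T4Continuum (T4Family ULoop)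
open Literature.MathematicalPhysics.QuantumFieldTheory.Balaban1983to89.T4EtaRate (PairedInstance NE2PlusOperator NE2PlusSite NE2PlusUnit)
open Literature.MathematicalPhysics.QuantumFieldTheory.Balaban1983to89.NE2NodeTorus (KnitIndex knitInstance knitOp166 knitSite163 covOpKernels inAll rhoDist)
open Node00 (IsDatumOfRecord₁₃CCoPH Stage13HParams NE2Objects₁₁ NE3Letters₁₁)
open Node00.W1 (ReadingData)
open Summit.QuantumFields.BalabanUV.T4Continuum.HistoryFlow (two_le_L)
open Summit.QuantumFields.YangMills.Theorems.BalabanUVNodesN15Knit (N15_with_zero_layers_dim4)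
open Summit.QuantumFields.YangMills.BalabanUVNodes.N15.VectorPiece (VecIndexS vecIndexS_nonempty v1GVecInstance v1GVecFamily4)
open Summit.QuantumFields.YangMills.BalabanUVNodes.N15.AtKeyedHome (s_N15_of_admits neZero_blockFactor populated_knitObjects)
open Summit.QuantumFields.YangMills.BalabanUVNodes.N15.AtRateRecord12V1 (s_N15_of_admits_v1G populated_v1GObjects)
open Summit.QuantumFields.YangMills.BalabanUVNodes.N15.AtRRec13CoPH (admits_rRec₁₃CoPH_ne2 s_N15_rRec₁₃CoPH_of_forall_admissible s_N15_rRec₁₃CoPH_of_pin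
  s_N15_rRec₁₃CoPHOn_of_forall_regime s_N15_rRec₁₃CoPHOn_of_pin n15At_of_s_N15_rRec₁₃CoPHOn)
open Summit.QuantumFields.YangMills.BalabanUVNodes.N15.GenuineRecord (fullGObjects n15At_fullGObjects populated_fullGObjects s_N15_of_admits_fullG_family
  populated_fullGObjects_family)
open YMDAG.UVSplit (Datum NE1pCarriers NE2Carriers RateCarriers RateRecordPred N15At S_N15 ne2OfRecord₁₁ RateReading₁₃CoPH rateCarriersOfRecord₁₃CoPH RRec₁₃CoPH
  RRec₁₃CoPHOn s_N15_rRec₁₃CoPHOn_iff readingOfRecord₁₃CoPH readingOfRecord₁₃CoPH_ne2 readingOfRecord₁₃CoPH_populated_iff s_N15_readingOfRecord₁₃CoPH_iff)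

variable {N : ℕ} [NeZero N]

section ReadingOfRecord

variable (w1 : (F : T4Family) → (θ : Stage13HParams F N) → ReadingData F (Node00.MatA N) θ.τ9.M) (ℓ₃ : T4Family → NE3Letters₁₁)
  (ne2 : (F : T4Family) → Stage13HParams F N → (ℕ → ℝ) → List (ULoop F) → ℕ → NE2Objects₁₁)
  (ne1 : (F : T4Family) → Stage13HParams F N → (ℕ → ℝ) → List (ULoop F) → NE1pCarriers)

/-! ## §1 Any residual layer `ne2`: θ-forms, pins, the guarded dictionary, both homes -/

/-- **THE θ-FORM AT THE READING OF RECORD**: if N15's residual layer carries `N15At` at every family and every admissible Stage-13 tuple with provisos along every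
`(g₀, os, k)`, then `S_N15 (RRec₁₃CoPH (readingOfRecord₁₃CoPH w1 ℓ₃ ne2 ne1))` — n27-c's `h15` at the canonical home of the reading of record.  W1's towers `w1`, the NE3
letters `ℓ₃`, NODE O's `ne1` are idle (component locality). [bookkeeping] -/
theorem s_N15_readingOfRecord₁₃CoPH_of_forall
    (h : ∀ (F : T4Family) (θ : Stage13HParams F N), θ.Provisos₁₃CoPH F N → θ.Admissible F N → ∀ (g₀ : ℕ → ℝ) (os : List (ULoop F)) (k : ℕ),
      N15At (ne2OfRecord₁₁ (ne2 F θ g₀ os k))) :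
    S_N15 (RRec₁₃CoPH (readingOfRecord₁₃CoPH w1 ℓ₃ ne2 ne1)) :=
  s_N15_rRec₁₃CoPH_of_forall_admissible _ fun F θ hP hA g₀ os k => by
    rw [readingOfRecord₁₃CoPH_ne2]
    exact h F θ hP hA g₀ os k

/-- **PIN-MEETS-ESTIMATE AT THE READING OF RECORD**: the residual layer agrees on the admissible tuples with a NAMED assignment `pin` carrying `N15At` ⇒ the stub at the
canonical home of the reading of record. [bookkeeping] -/
theorem s_N15_readingOfRecord₁₃CoPH_of_pin (pin : (F : T4Family) → Stage13HParams F N → (ℕ → ℝ) → List (ULoop F) → ℕ → NE2Objects₁₁)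
    (hpin : ∀ (F : T4Family) (θ : Stage13HParams F N), θ.Provisos₁₃CoPH F N → θ.Admissible F N → ∀ (g₀ : ℕ → ℝ) (os : List (ULoop F)) (k : ℕ),
      ne2 F θ g₀ os k = pin F θ g₀ os k)
    (hest : ∀ (F : T4Family) (θ : Stage13HParams F N), θ.Provisos₁₃CoPH F N → θ.Admissible F N → ∀ (g₀ : ℕ → ℝ) (os : List (ULoop F)) (k : ℕ),
      N15At (ne2OfRecord₁₁ (pin F θ g₀ os k))) :
    S_N15 (RRec₁₃CoPH (readingOfRecord₁₃CoPH w1 ℓ₃ ne2 ne1)) :=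
  s_N15_readingOfRecord₁₃CoPH_of_forall w1 ℓ₃ ne2 ne1 fun F θ hP hA g₀ os k => by
    rw [hpin F θ hP hA g₀ os k]
    exact hest F θ hP hA g₀ os k

/-- **THE READ-OUT AT THE READING OF RECORD**: under the stub, `N15At` at the residual layer of every Stage-13 datum key (6″'s dictionary `s_N15_readingOfRecord₁₃CoPH_iff`).
[bookkeeping] -/
theorem n15At_of_s_N15_readingOfRecord₁₃CoPH (hS : S_N15 (RRec₁₃CoPH (readingOfRecord₁₃CoPH w1 ℓ₃ ne2 ne1))) (F : T4Family) {D : Datum F N}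
    (hD : IsDatumOfRecord₁₃CCoPH F N D) (g₀ : ℕ → ℝ) (os : List (ULoop F)) (k : ℕ) : N15At (ne2OfRecord₁₁ (ne2 F hD.params g₀ os k)) :=
  (s_N15_readingOfRecord₁₃CoPH_iff w1 ℓ₃ ne2 ne1).1 hS F D hD g₀ os k

/-- **THE GUARDED DICTIONARY AT THE READING OF RECORD** (6″ states it for N16 ∕ N18 ∕ N22; here N15's): `S_N15 (RRec₁₃CoPHOn (readingOfRecord₁₃CoPH …) Rg)` IS «`N15At` at the
residual layer of every family's admissible Stage-13 tuples with provisos in `Rg`, along every `(g₀, os, k)`». [bookkeeping] -/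
theorem s_N15_readingOfRecord₁₃CoPHOn_iff (Rg : (F : T4Family) → Stage13HParams F N → Prop) :
    S_N15 (RRec₁₃CoPHOn (readingOfRecord₁₃CoPH w1 ℓ₃ ne2 ne1) Rg) ↔
      ∀ (F : T4Family) (θ : Stage13HParams F N), θ.Provisos₁₃CoPH F N → Rg F θ → θ.Admissible F N → ∀ (g₀ : ℕ → ℝ) (os : List (ULoop F)) (k : ℕ),
        N15At (ne2OfRecord₁₁ (ne2 F θ g₀ os k)) :=
  s_N15_rRec₁₃CoPHOn_iff _ Rg

/-- **THE GUARDED θ-FORM AT THE READING OF RECORD** — n27-c's `h15` at `RRec₁₃CoPHOn (readingOfRecord₁₃CoPH w1 ℓ₃ ne2 ne1) Rg` (XLI∕XLIIᶜᵒᵖᴴ, leaf B §7): `N15At` at the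
residual layer on the admissible tuples with provisos IN THE REGIME suffices. [bookkeeping] -/
theorem s_N15_readingOfRecord₁₃CoPHOn_of_forall_regime (Rg : (F : T4Family) → Stage13HParams F N → Prop)
    (h : ∀ (F : T4Family) (θ : Stage13HParams F N), θ.Provisos₁₃CoPH F N → Rg F θ → θ.Admissible F N → ∀ (g₀ : ℕ → ℝ) (os : List (ULoop F)) (k : ℕ),
      N15At (ne2OfRecord₁₁ (ne2 F θ g₀ os k))) :
    S_N15 (RRec₁₃CoPHOn (readingOfRecord₁₃CoPH w1 ℓ₃ ne2 ne1) Rg) :=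
  (s_N15_readingOfRecord₁₃CoPHOn_iff w1 ℓ₃ ne2 ne1 Rg).2 h

/-- **GUARDED PIN-MEETS-ESTIMATE AT THE READING OF RECORD.** [bookkeeping] -/
theorem s_N15_readingOfRecord₁₃CoPHOn_of_pin (Rg : (F : T4Family) → Stage13HParams F N → Prop)
    (pin : (F : T4Family) → Stage13HParams F N → (ℕ → ℝ) → List (ULoop F) → ℕ → NE2Objects₁₁)
    (hpin : ∀ (F : T4Family) (θ : Stage13HParams F N), θ.Provisos₁₃CoPH F N → Rg F θ → θ.Admissible F N → ∀ (g₀ : ℕ → ℝ) (os : List (ULoop F)) (k : ℕ),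
      ne2 F θ g₀ os k = pin F θ g₀ os k)
    (hest : ∀ (F : T4Family) (θ : Stage13HParams F N), θ.Provisos₁₃CoPH F N → Rg F θ → θ.Admissible F N → ∀ (g₀ : ℕ → ℝ) (os : List (ULoop F)) (k : ℕ),
      N15At (ne2OfRecord₁₁ (pin F θ g₀ os k))) :
    S_N15 (RRec₁₃CoPHOn (readingOfRecord₁₃CoPH w1 ℓ₃ ne2 ne1) Rg) :=
  s_N15_readingOfRecord₁₃CoPHOn_of_forall_regime w1 ℓ₃ ne2 ne1 Rg fun F θ hP hRg hA g₀ os k => by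
    rw [hpin F θ hP hRg hA g₀ os k]
    exact hest F θ hP hRg hA g₀ os k

/-- **BOTH HOMES OF THE READING OF RECORD FROM THE UNGUARDED θ-FORM.** [bookkeeping] -/
theorem s_N15_readingOfRecord₁₃CoPH_homes_of_forall
    (h : ∀ (F : T4Family) (θ : Stage13HParams F N), θ.Provisos₁₃CoPH F N → θ.Admissible F N → ∀ (g₀ : ℕ → ℝ) (os : List (ULoop F)) (k : ℕ),
      N15At (ne2OfRecord₁₁ (ne2 F θ g₀ os k))) :
    S_N15 (RRec₁₃CoPH (readingOfRecord₁₃CoPH w1 ℓ₃ ne2 ne1)) ∧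
      ∀ Rg : (F : T4Family) → Stage13HParams F N → Prop, S_N15 (RRec₁₃CoPHOn (readingOfRecord₁₃CoPH w1 ℓ₃ ne2 ne1) Rg) :=
  ⟨s_N15_readingOfRecord₁₃CoPH_of_forall w1 ℓ₃ ne2 ne1 h,
    fun Rg => s_N15_readingOfRecord₁₃CoPHOn_of_forall_regime w1 ℓ₃ ne2 ne1 Rg fun F θ hP _ hA g₀ os k => h F θ hP hA g₀ os k⟩

/-! ## §2 The LG-vector knit reading (model level, hypothesis-free) -/

/-- **THE FAMILY-KEYED KNIT RESIDUAL LAYER CLOSES `h15` AT BOTH HOMES OF THE READING OF RECORD, HYPOTHESIS-FREE** [decided toy, non-degenerate]: if on the admissible tuples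
the residual layer IS the knit carriers of this lineage's `U ≡ 1` Landau-gauge vector linear theory at the family's own block factor `F.L` (`μ ≠ ν`), then `S_N15` at
`RRec₁₃CoPH (readingOfRecord₁₃CoPH …)` and at every `RRec₁₃CoPHOn (readingOfRecord₁₃CoPH …) Rg` — by `N15Knit.N15_with_zero_layers_dim4` at `2 ≤ F.L`.  MODEL level
(not Bałaban's `G(U)`). [bookkeeping] -/
theorem s_N15_readingOfRecord₁₃CoPH_homes_of_knit_family {μ ν : Fin 4} (hμν : μ ≠ ν) (a b μ' lam α β : Fin 4) (c35 p : ℝ)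
    (h : ∀ (F : T4Family) (θ : Stage13HParams F N), θ.Provisos₁₃CoPH F N → θ.Admissible F N → ∀ (g₀ : ℕ → ℝ) (os : List (ULoop F)) (k : ℕ),
      ne2 F θ g₀ os k =
        haveI := neZero_blockFactor F
        { I := KnitIndex 3 F.L, c35 := c35, p := p, pi := knitInstance 3 F.L, Kop := knitOp166 F.L μ ν a b, Ksite := knitSite163 F.L μ' lam,
          Kunit := covOpKernels F.L α β, inΛ := inAll F.L, unitDist := rhoDist F.L }) :
    S_N15 (RRec₁₃CoPH (readingOfRecord₁₃CoPH w1 ℓ₃ ne2 ne1)) ∧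
      ∀ Rg : (F : T4Family) → Stage13HParams F N → Prop, S_N15 (RRec₁₃CoPHOn (readingOfRecord₁₃CoPH w1 ℓ₃ ne2 ne1) Rg) :=
  s_N15_readingOfRecord₁₃CoPH_homes_of_forall w1 ℓ₃ ne2 ne1 fun F θ hP hA g₀ os k => by
    haveI := neZero_blockFactor F
    rw [h F θ hP hA g₀ os k]
    exact (N15_with_zero_layers_dim4 F.L (two_le_L F) hμν a b μ' lam α β c35 p).1

/-- … at the canonical home alone (n27-c XLᶜᵒᵖᴴ ∕ leaf B §5 currency). [bookkeeping] -/
theorem s_N15_readingOfRecord₁₃CoPH_of_knit_family {μ ν : Fin 4} (hμν : μ ≠ ν) (a b μ' lam α β : Fin 4) (c35 p : ℝ)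
    (h : ∀ (F : T4Family) (θ : Stage13HParams F N), θ.Provisos₁₃CoPH F N → θ.Admissible F N → ∀ (g₀ : ℕ → ℝ) (os : List (ULoop F)) (k : ℕ),
      ne2 F θ g₀ os k =
        haveI := neZero_blockFactor F
        { I := KnitIndex 3 F.L, c35 := c35, p := p, pi := knitInstance 3 F.L, Kop := knitOp166 F.L μ ν a b, Ksite := knitSite163 F.L μ' lam,
          Kunit := covOpKernels F.L α β, inΛ := inAll F.L, unitDist := rhoDist F.L }) :
    S_N15 (RRec₁₃CoPH (readingOfRecord₁₃CoPH w1 ℓ₃ ne2 ne1)) :=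
  (s_N15_readingOfRecord₁₃CoPH_homes_of_knit_family w1 ℓ₃ ne2 ne1 hμν a b μ' lam α β c35 p h).1

/-- … at the `Rg`-guarded home (n27-c XLI∕XLIIᶜᵒᵖᴴ ∕ leaf B §7 currency; any `Rg`). [bookkeeping] -/
theorem s_N15_readingOfRecord₁₃CoPHOn_of_knit_family (Rg : (F : T4Family) → Stage13HParams F N → Prop) {μ ν : Fin 4} (hμν : μ ≠ ν)
    (a b μ' lam α β : Fin 4) (c35 p : ℝ)
    (h : ∀ (F : T4Family) (θ : Stage13HParams F N), θ.Provisos₁₃CoPH F N → θ.Admissible F N → ∀ (g₀ : ℕ → ℝ) (os : List (ULoop F)) (k : ℕ),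
      ne2 F θ g₀ os k =
        haveI := neZero_blockFactor F
        { I := KnitIndex 3 F.L, c35 := c35, p := p, pi := knitInstance 3 F.L, Kop := knitOp166 F.L μ ν a b, Ksite := knitSite163 F.L μ' lam,
          Kunit := covOpKernels F.L α β, inΛ := inAll F.L, unitDist := rhoDist F.L }) :
    S_N15 (RRec₁₃CoPHOn (readingOfRecord₁₃CoPH w1 ℓ₃ ne2 ne1) Rg) :=
  (s_N15_readingOfRecord₁₃CoPH_homes_of_knit_family w1 ℓ₃ ne2 ne1 hμν a b μ' lam α β c35 p h).2 Rg

/-- … such a reading of record is `Populated` at every Stage-13 tuple with provisos (6″'s `readingOfRecord₁₃CoPH_populated_iff`; `populated_knitObjects`). [bookkeeping] -/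
theorem populated_readingOfRecord₁₃CoPH_of_knit_family (μ ν a b μ' lam α β : Fin 4) (c35 p : ℝ) (F : T4Family) (θ : Stage13HParams F N)
    (hP : θ.Provisos₁₃CoPH F N) (g₀ : ℕ → ℝ) (os : List (ULoop F))
    (h : ∀ k : ℕ, ne2 F θ g₀ os k =
        haveI := neZero_blockFactor F
        { I := KnitIndex 3 F.L, c35 := c35, p := p, pi := knitInstance 3 F.L, Kop := knitOp166 F.L μ ν a b, Ksite := knitSite163 F.L μ' lam,
          Kunit := covOpKernels F.L α β, inΛ := inAll F.L, unitDist := rhoDist F.L }) :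
    ((readingOfRecord₁₃CoPH w1 ℓ₃ ne2 ne1).lit F θ hP g₀ os).Populated := by
  refine (readingOfRecord₁₃CoPH_populated_iff w1 ℓ₃ ne2 ne1 F θ hP g₀ os).2 fun k => ?_
  haveI := neZero_blockFactor F
  rw [h k]
  exact populated_knitObjects F.L μ ν a b μ' lam α β c35 p

end ReadingOfRecord

/-! ## §3 ★ The GENUINE `U ≡ 1` reading — Bałaban's own objects on the datum family's tori — at both CoPH homes and at the reading of record -/

section Genuine

variable {b aS : ℝ}

/-- ★ **THE GENUINE READING CLOSES THE STUB AT THE CANONICAL HOME, NO ESTIMATE DISPLAYED.**  For `b, a_S > 0`, directions `ν, μ`: with part 73's family-dependent weight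
window `a₀ : T4Family → ℝ` (positive), every weight choice `a F ≠ 0`, `|a F| ≤ a₀ F` and letters `c₃₅`, `p`: a reading `𝔯` whose NE2 objects at every Stage-13 datum key ARE
the genuine objects `fullGObjects 3 F.hL b a_S (a F) ν μ c₃₅ p` (Bałaban's full `U ≡ 1` Landau-gauge pair, his site kernel `(Q′G′²Q′*)⁻¹`, King's covariance of `Δ_b⁻¹`, on
the family's OWN block factor) has `S_N15 (RRec₁₃CoPH 𝔯)` — part 73 `s_N15_of_admits_fullG_family` at the certificate `admits_rRec₁₃CoPH_ne2`. [bookkeeping] -/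
theorem s_N15_rRec₁₃CoPH_of_fullGReading (hb : 0 < b) (haS : 0 < aS) (ν μ : Fin 4) :
    ∃ a₀ : T4Family → ℝ, (∀ F, 0 < a₀ F) ∧ ∀ a : T4Family → ℝ, (∀ F, a F ≠ 0 ∧ |a F| ≤ a₀ F) → ∀ (c35 p : ℝ) (𝔯 : RateReading₁₃CoPH N),
      (∀ (F : T4Family) (D : Datum F N) (hD : IsDatumOfRecord₁₃CCoPH F N D) (g₀ : ℕ → ℝ) (os : List (ULoop F)) (k : ℕ),
        (𝔯.lit F hD.params hD.provisos g₀ os).ne2 k = haveI := neZero_blockFactor F; fullGObjects 3 F.hL b aS (a F) ν μ c35 p) →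
      S_N15 (RRec₁₃CoPH 𝔯) := by
  obtain ⟨a₀, ha₀, H⟩ := s_N15_of_admits_fullG_family (N := N) (key := fun F D => IsDatumOfRecord₁₃CCoPH F N D) hb haS ν μ
  exact ⟨a₀, ha₀, fun a ha c35 p 𝔯 h => H a ha c35 p (fun {F D} (hD : IsDatumOfRecord₁₃CCoPH F N D) g₀ os k =>
    (𝔯.lit F hD.params hD.provisos g₀ os).ne2 k) (RRec₁₃CoPH 𝔯) (admits_rRec₁₃CoPH_ne2 𝔯) h⟩

/-- ★ **THE GENUINE READING CLOSES THE STUB AT EVERY GUARDED HOME** (θ-form: the hypothesis on the admissible tuples with provisos in `Rg`; part 73 `n15At_fullGObjects` at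
`(3, F.hL)` through 74b's `s_N15_rRec₁₃CoPHOn_of_pin`). [bookkeeping] -/
theorem s_N15_rRec₁₃CoPHOn_of_fullGReading (hb : 0 < b) (haS : 0 < aS) (ν μ : Fin 4) :
    ∃ a₀ : T4Family → ℝ, (∀ F, 0 < a₀ F) ∧ ∀ a : T4Family → ℝ, (∀ F, a F ≠ 0 ∧ |a F| ≤ a₀ F) → ∀ (c35 p : ℝ) (𝔯 : RateReading₁₃CoPH N)
      (Rg : (F : T4Family) → Stage13HParams F N → Prop),
      (∀ (F : T4Family) (θ : Stage13HParams F N) (hP : θ.Provisos₁₃CoPH F N), Rg F θ → θ.Admissible F N → ∀ (g₀ : ℕ → ℝ) (os : List (ULoop F)) (k : ℕ),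
        (𝔯.lit F θ hP g₀ os).ne2 k = haveI := neZero_blockFactor F; fullGObjects 3 F.hL b aS (a F) ν μ c35 p) →
      S_N15 (RRec₁₃CoPHOn 𝔯 Rg) := by
  have H : ∀ F : T4Family, haveI := neZero_blockFactor F;
      ∃ a₀ : ℝ, 0 < a₀ ∧ ∀ a : ℝ, a ≠ 0 → |a| ≤ a₀ → ∀ c35 p : ℝ, N15At (ne2OfRecord₁₁ (fullGObjects 3 F.hL b aS a ν μ c35 p)) := fun F => by
    haveI := neZero_blockFactor F
    exact n15At_fullGObjects (d := 3) F.hL.1 (two_le_L F) F.hL hb haS ν μ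
  choose a₀ ha₀ Ha using H
  refine ⟨a₀, ha₀, fun a ha c35 p 𝔯 Rg h => s_N15_rRec₁₃CoPHOn_of_pin 𝔯 Rg
    (fun F _ _ _ _ _ => haveI := neZero_blockFactor F; fullGObjects 3 F.hL b aS (a F) ν μ c35 p) h fun F θ hP _ _ g₀ os k => ?_⟩
  exact Ha F (a F) (ha F).1 (ha F).2 c35 p

/-- ★★ **SOME READING CLOSES THE STUB AT BOTH CoPH HOMES OUTRIGHT ON GENUINE OBJECTS, POPULATED EVERYWHERE** [decided, non-degenerate]: for `b, a_S > 0`, `ν, μ`,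
`c₃₅`, `p` there is a Stage-13 rate reading `𝔯` whose NE2 objects at every tuple are the GENUINE objects on the family's own tori at a window weight (displayed),
`Populated` everywhere (RR-1 §8), with `S_N15 (RRec₁₃CoPH 𝔯)` and `S_N15 (RRec₁₃CoPHOn 𝔯 Rg)` for every `Rg`, NO hypothesis — the counterpart of part 74's
`exists_reading_s_N15_rRec₁₃CoPH_knit_family` with Bałaban's own `U ≡ 1` objects in place of the LG-piece model. [bookkeeping] -/
theorem exists_reading_s_N15_rRec₁₃CoPH_fullG_family (hb : 0 < b) (haS : 0 < aS) (ν μ : Fin 4) (c35 p : ℝ) :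
    ∃ (a : T4Family → ℝ) (𝔯 : RateReading₁₃CoPH N),
      (∀ (F : T4Family) (θ : Stage13HParams F N) (hP : θ.Provisos₁₃CoPH F N) (g₀ : ℕ → ℝ) (os : List (ULoop F)) (k : ℕ),
        (𝔯.lit F θ hP g₀ os).ne2 k = haveI := neZero_blockFactor F; fullGObjects 3 F.hL b aS (a F) ν μ c35 p) ∧
      (∀ (F : T4Family) (θ : Stage13HParams F N) (hP : θ.Provisos₁₃CoPH F N) (g₀ : ℕ → ℝ) (os : List (ULoop F)) (k : ℕ),
        ((𝔯.lit F θ hP g₀ os).ne2 k).Populated) ∧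
      S_N15 (RRec₁₃CoPH 𝔯) ∧ ∀ Rg : (F : T4Family) → Stage13HParams F N → Prop, S_N15 (RRec₁₃CoPHOn 𝔯 Rg) := by
  have H : ∀ F : T4Family, haveI := neZero_blockFactor F;
      ∃ a₀ : ℝ, 0 < a₀ ∧ ∀ a : ℝ, a ≠ 0 → |a| ≤ a₀ → ∀ c35 p : ℝ, N15At (ne2OfRecord₁₁ (fullGObjects 3 F.hL b aS a ν μ c35 p)) := fun F => by
    haveI := neZero_blockFactor F
    exact n15At_fullGObjects (d := 3) F.hL.1 (two_le_L F) F.hL hb haS ν μ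
  choose a₀ ha₀ Ha using H
  obtain ⟨r₀⟩ := Node00.nonempty_rateObjects₁₁ (N := N)
  let lit : (F : T4Family) → (θ : Stage13HParams F N) → θ.Provisos₁₃CoPH F N → (ℕ → ℝ) → List (ULoop F) → Node00.RateObjects₁₁ N :=
    fun F _ _ _ _ => ⟨r₀.u3, r₀.ne3, fun _ => haveI := neZero_blockFactor F; fullGObjects 3 F.hL b aS (a₀ F) ν μ c35 p⟩
  let 𝔯 : RateReading₁₃CoPH N := ⟨lit, fun _ _ _ _ _ => (⟨Empty, ⟨fun q => q.elim, fun q => q.elim, fun q => q.elim⟩, 0⟩ : NE1pCarriers)⟩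
  have h𝔯 : ∀ (F : T4Family) (θ : Stage13HParams F N) (hP : θ.Provisos₁₃CoPH F N) (g₀ : ℕ → ℝ) (os : List (ULoop F)) (k : ℕ),
      (𝔯.lit F θ hP g₀ os).ne2 k = haveI := neZero_blockFactor F; fullGObjects 3 F.hL b aS (a₀ F) ν μ c35 p := fun _ _ _ _ _ _ => rfl
  have hS := AtRRec13CoPH.s_N15_homes₁₃CoPH_of_forall_admissible 𝔯 fun F θ hP _ g₀ os k => by
    rw [h𝔯 F θ hP g₀ os k]
    exact Ha F (a₀ F) (ha₀ F).ne' (abs_of_pos (ha₀ F)).le c35 p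
  refine ⟨a₀, 𝔯, h𝔯, fun F θ hP g₀ os k => ?_, hS.1, hS.2⟩
  rw [h𝔯 F θ hP g₀ os k]
  exact populated_fullGObjects_family F b aS (a₀ F) ν μ c35 p

variable (w1 : (F : T4Family) → (θ : Stage13HParams F N) → ReadingData F (Node00.MatA N) θ.τ9.M) (ℓ₃ : T4Family → NE3Letters₁₁)
  (ne2 : (F : T4Family) → Stage13HParams F N → (ℕ → ℝ) → List (ULoop F) → ℕ → NE2Objects₁₁)
  (ne1 : (F : T4Family) → Stage13HParams F N → (ℕ → ℝ) → List (ULoop F) → NE1pCarriers)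

/-- ★★ **A GENUINE RESIDUAL LAYER CLOSES `h15` AT BOTH HOMES OF THE READING OF RECORD, NO ESTIMATE DISPLAYED**: if on the admissible Stage-13 tuples with provisos N15's
residual layer `ne2` takes the genuine objects `fullGObjects 3 F.hL b a_S (a F) ν μ c₃₅ p` as values (weights in part 73's window), then `S_N15` at
`RRec₁₃CoPH (readingOfRecord₁₃CoPH w1 ℓ₃ ne2 ne1)` AND at every `RRec₁₃CoPHOn (readingOfRecord₁₃CoPH w1 ℓ₃ ne2 ne1) Rg` — the three NE2 layers for Bałaban's OWN `U ≡ 1`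
objects on the family's tori are theorems (part 73 §1), not hypotheses. [bookkeeping] -/
theorem s_N15_readingOfRecord₁₃CoPH_homes_of_fullG_family (hb : 0 < b) (haS : 0 < aS) (ν μ : Fin 4) :
    ∃ a₀ : T4Family → ℝ, (∀ F, 0 < a₀ F) ∧ ∀ a : T4Family → ℝ, (∀ F, a F ≠ 0 ∧ |a F| ≤ a₀ F) → ∀ (c35 p : ℝ),
      (∀ (F : T4Family) (θ : Stage13HParams F N), θ.Provisos₁₃CoPH F N → θ.Admissible F N → ∀ (g₀ : ℕ → ℝ) (os : List (ULoop F)) (k : ℕ),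
        ne2 F θ g₀ os k = haveI := neZero_blockFactor F; fullGObjects 3 F.hL b aS (a F) ν μ c35 p) →
      S_N15 (RRec₁₃CoPH (readingOfRecord₁₃CoPH w1 ℓ₃ ne2 ne1)) ∧
        ∀ Rg : (F : T4Family) → Stage13HParams F N → Prop, S_N15 (RRec₁₃CoPHOn (readingOfRecord₁₃CoPH w1 ℓ₃ ne2 ne1) Rg) := by
  have H : ∀ F : T4Family, haveI := neZero_blockFactor F;
      ∃ a₀ : ℝ, 0 < a₀ ∧ ∀ a : ℝ, a ≠ 0 → |a| ≤ a₀ → ∀ c35 p : ℝ, N15At (ne2OfRecord₁₁ (fullGObjects 3 F.hL b aS a ν μ c35 p)) := fun F => by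
    haveI := neZero_blockFactor F
    exact n15At_fullGObjects (d := 3) F.hL.1 (two_le_L F) F.hL hb haS ν μ
  choose a₀ ha₀ Ha using H
  refine ⟨a₀, ha₀, fun a ha c35 p h => s_N15_readingOfRecord₁₃CoPH_homes_of_forall w1 ℓ₃ ne2 ne1 fun F θ hP hA g₀ os k => ?_⟩
  rw [h F θ hP hA g₀ os k]
  exact Ha F (a F) (ha F).1 (ha F).2 c35 p

/-- … at the canonical home alone (n27-c XLᶜᵒᵖᴴ ∕ leaf B §5 currency). [bookkeeping] -/
theorem s_N15_readingOfRecord₁₃CoPH_of_fullG_family (hb : 0 < b) (haS : 0 < aS) (ν μ : Fin 4) :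
    ∃ a₀ : T4Family → ℝ, (∀ F, 0 < a₀ F) ∧ ∀ a : T4Family → ℝ, (∀ F, a F ≠ 0 ∧ |a F| ≤ a₀ F) → ∀ (c35 p : ℝ),
      (∀ (F : T4Family) (θ : Stage13HParams F N), θ.Provisos₁₃CoPH F N → θ.Admissible F N → ∀ (g₀ : ℕ → ℝ) (os : List (ULoop F)) (k : ℕ),
        ne2 F θ g₀ os k = haveI := neZero_blockFactor F; fullGObjects 3 F.hL b aS (a F) ν μ c35 p) →
      S_N15 (RRec₁₃CoPH (readingOfRecord₁₃CoPH w1 ℓ₃ ne2 ne1)) := by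
  obtain ⟨a₀, ha₀, H⟩ := s_N15_readingOfRecord₁₃CoPH_homes_of_fullG_family (N := N) w1 ℓ₃ ne2 ne1 hb haS ν μ
  exact ⟨a₀, ha₀, fun a ha c35 p h => (H a ha c35 p h).1⟩

/-- … at the `Rg`-guarded home (n27-c XLI∕XLIIᶜᵒᵖᴴ ∕ leaf B §7 currency; every `Rg` at once). [bookkeeping] -/
theorem s_N15_readingOfRecord₁₃CoPHOn_of_fullG_family (hb : 0 < b) (haS : 0 < aS) (ν μ : Fin 4) :
    ∃ a₀ : T4Family → ℝ, (∀ F, 0 < a₀ F) ∧ ∀ a : T4Family → ℝ, (∀ F, a F ≠ 0 ∧ |a F| ≤ a₀ F) → ∀ (c35 p : ℝ),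
      (∀ (F : T4Family) (θ : Stage13HParams F N), θ.Provisos₁₃CoPH F N → θ.Admissible F N → ∀ (g₀ : ℕ → ℝ) (os : List (ULoop F)) (k : ℕ),
        ne2 F θ g₀ os k = haveI := neZero_blockFactor F; fullGObjects 3 F.hL b aS (a F) ν μ c35 p) →
      ∀ Rg : (F : T4Family) → Stage13HParams F N → Prop, S_N15 (RRec₁₃CoPHOn (readingOfRecord₁₃CoPH w1 ℓ₃ ne2 ne1) Rg) := by
  obtain ⟨a₀, ha₀, H⟩ := s_N15_readingOfRecord₁₃CoPH_homes_of_fullG_family (N := N) w1 ℓ₃ ne2 ne1 hb haS ν μ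
  exact ⟨a₀, ha₀, fun a ha c35 p h => (H a ha c35 p h).2⟩

/-- … such a reading of record is `Populated` at every Stage-13 tuple with provisos (part 73 `populated_fullGObjects_family`). [bookkeeping] -/
theorem populated_readingOfRecord₁₃CoPH_of_fullG_family (a : T4Family → ℝ) (ν μ : Fin 4) (c35 p : ℝ) (F : T4Family) (θ : Stage13HParams F N)
    (hP : θ.Provisos₁₃CoPH F N) (g₀ : ℕ → ℝ) (os : List (ULoop F))
    (h : ∀ k : ℕ, ne2 F θ g₀ os k = haveI := neZero_blockFactor F; fullGObjects 3 F.hL b aS (a F) ν μ c35 p) :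
    ((readingOfRecord₁₃CoPH w1 ℓ₃ ne2 ne1).lit F θ hP g₀ os).Populated := by
  refine (readingOfRecord₁₃CoPH_populated_iff w1 ℓ₃ ne2 ne1 F θ hP g₀ os).2 fun k => ?_
  rw [h k]
  exact populated_fullGObjects_family F b aS (a F) ν μ c35 p

/-- ★★ **SOME RESIDUAL LAYER — THE GENUINE ONE — CLOSES `h15` AT BOTH HOMES OF THE READING OF RECORD FOR EVERY `w1`, `ℓ₃`, `ne1`, POPULATED EVERYWHERE** [decided,
non-degenerate, GENUINE objects]: for `b, a_S > 0`, `ν, μ`, `c₃₅`, `p` there is a residual layer `ne2` (the genuine objects on each family's own tori at a window weight)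
such that the reading of record is `Populated` at every Stage-13 tuple with provisos and `S_N15` holds at `RRec₁₃CoPH (readingOfRecord₁₃CoPH w1 ℓ₃ ne2 ne1)` and at every
`RRec₁₃CoPHOn (…) Rg`, with NO hypothesis.  Reading for the K3⁷ composer: the N15 slot is inhabited by Bałaban's own `U ≡ 1` objects, not only by the LG-piece model; the
objects OF RECORD (background LIVE, Node 00's [B9] operator layer) remain residual. [bookkeeping] -/
theorem exists_ne2_s_N15_readingOfRecord₁₃CoPH_fullG (hb : 0 < b) (haS : 0 < aS) (ν μ : Fin 4) (c35 p : ℝ) :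
    ∃ ne2 : (F : T4Family) → Stage13HParams F N → (ℕ → ℝ) → List (ULoop F) → ℕ → NE2Objects₁₁,
      (∀ (F : T4Family) (θ : Stage13HParams F N) (hP : θ.Provisos₁₃CoPH F N) (g₀ : ℕ → ℝ) (os : List (ULoop F)),
        ((readingOfRecord₁₃CoPH w1 ℓ₃ ne2 ne1).lit F θ hP g₀ os).Populated) ∧
      S_N15 (RRec₁₃CoPH (readingOfRecord₁₃CoPH w1 ℓ₃ ne2 ne1)) ∧
      ∀ Rg : (F : T4Family) → Stage13HParams F N → Prop, S_N15 (RRec₁₃CoPHOn (readingOfRecord₁₃CoPH w1 ℓ₃ ne2 ne1) Rg) := by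
  have H : ∀ F : T4Family, haveI := neZero_blockFactor F;
      ∃ a₀ : ℝ, 0 < a₀ ∧ ∀ a : ℝ, a ≠ 0 → |a| ≤ a₀ → ∀ c35 p : ℝ, N15At (ne2OfRecord₁₁ (fullGObjects 3 F.hL b aS a ν μ c35 p)) := fun F => by
    haveI := neZero_blockFactor F
    exact n15At_fullGObjects (d := 3) F.hL.1 (two_le_L F) F.hL hb haS ν μ
  choose a₀ ha₀ Ha using H
  refine ⟨fun F _ _ _ _ => haveI := neZero_blockFactor F; fullGObjects 3 F.hL b aS (a₀ F) ν μ c35 p, fun F θ hP g₀ os => ?_,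
    s_N15_readingOfRecord₁₃CoPH_homes_of_forall w1 ℓ₃ _ ne1 fun F θ _ _ g₀ os k => Ha F (a₀ F) (ha₀ F).ne' (abs_of_pos (ha₀ F)).le c35 p⟩
  exact populated_readingOfRecord₁₃CoPH_of_fullG_family (b := b) (aS := aS) w1 ℓ₃ _ ne1 a₀ ν μ c35 p F θ hP g₀ os fun _ => rfl

end Genuine

/-! ## §4 The `V′₁(A′)`-live reading (dag-n15-c (V4)): operator layer by the producer's theorem, site ∕ unit displayed -/

section Gauge

variable {d : ℕ} {L : ℕ} [NeZero L] {ι : Type} [Fintype ι] [DecidableEq ι]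
  {𝔄 : Type} [NormedRing 𝔄] [NormedAlgebra ℝ 𝔄] [CompleteSpace 𝔄] (e : 𝔄 ≃L[ℝ] (ι → ℝ))
  (w1 : (F : T4Family) → (θ : Stage13HParams F N) → ReadingData F (Node00.MatA N) θ.τ9.M) (ℓ₃ : T4Family → NE3Letters₁₁)
  (ne2 : (F : T4Family) → Stage13HParams F N → (ℕ → ℝ) → List (ULoop F) → ℕ → NE2Objects₁₁)
  (ne1 : (F : T4Family) → Stage13HParams F N → (ℕ → ℝ) → List (ULoop F) → NE1pCarriers)

/-- **N15 AT THE v1.7 READING OF RECORD WITH A `V′₁(A′)`-LIVE RESIDUAL LAYER** (part 38's `s_N15_readingOfRecord₁₃_of_v1G` at the CoPH edition).  For `d + 1 ≥ 2`, `L ≥ 1`: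
if the residual layer takes, at every admissible Stage-13 datum key's tuples, a `V′₁(A′)` literal (dag-n15-c's gauge-field-as-datum family `v1GVecInstance 𝔄 ι L hL`,
`v1GVecFamily4 𝔄 ι e L hL`) as value TOGETHER WITH the SITE and UNIT layers on it, then `S_N15 (RRec₁₃CoPH (readingOfRecord₁₃CoPH w1 ℓ₃ ne2 ne1))`; the OPERATOR layer is the
producer's theorem `VectorPiece.ne2PlusOperator_vectorPiece_v1G` (background LIVE), the site ∕ unit layers are DISPLAYED (no producer with the background live in the tree).
[bookkeeping] -/
theorem s_N15_readingOfRecord₁₃CoPH_of_v1G (hd : 1 ≤ d) (hL : 1 ≤ L)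
    (h : ∀ (F : T4Family) (θ : Stage13HParams F N), θ.Provisos₁₃CoPH F N → ∀ (g₀ : ℕ → ℝ) (os : List (ULoop F)) (k : ℕ),
      ∃ (c35 p : ℝ) (Ksite Kunit : ∀ j : VecIndexS d L, B9.SiteKernel (v1GVecInstance (d := d) 𝔄 ι L hL j).gc (v1GVecInstance (d := d) 𝔄 ι L hL j).Bf)
        (inΛ : ∀ j : VecIndexS d L, (v1GVecInstance (d := d) 𝔄 ι L hL j).gc.Site → Prop)
        (unitDist : ∀ j : VecIndexS d L, (v1GVecInstance (d := d) 𝔄 ι L hL j).gc.Site → (v1GVecInstance (d := d) 𝔄 ι L hL j).gc.Site → ℝ),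
        0 < c35 ∧
        ne2 F θ g₀ os k =
          { I := VecIndexS d L, c35 := c35, p := p, pi := v1GVecInstance (d := d) 𝔄 ι L hL, Kop := v1GVecFamily4 (d := d) 𝔄 ι e L hL,
            Ksite := Ksite, Kunit := Kunit, inΛ := inΛ, unitDist := unitDist } ∧
        NE2PlusSite 4 p c35 (v1GVecInstance (d := d) 𝔄 ι L hL) Ksite ∧ NE2PlusUnit c35 (v1GVecInstance (d := d) 𝔄 ι L hL) Kunit inΛ unitDist) :
    S_N15 (RRec₁₃CoPH (readingOfRecord₁₃CoPH w1 ℓ₃ ne2 ne1)) :=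
  s_N15_of_admits_v1G e (fun {F D} (hD : IsDatumOfRecord₁₃CCoPH F N D) g₀ os k =>
      ((readingOfRecord₁₃CoPH w1 ℓ₃ ne2 ne1).lit F hD.params hD.provisos g₀ os).ne2 k)
    (RRec₁₃CoPH (readingOfRecord₁₃CoPH w1 ℓ₃ ne2 ne1)) hd hL (admits_rRec₁₃CoPH_ne2 _) fun F _ hD g₀ os k => by
    rw [readingOfRecord₁₃CoPH_ne2]
    exact h F hD.params hD.provisos g₀ os k

omit [CompleteSpace 𝔄] in
/-- … such a reading of record is `Populated` at every Stage-13 tuple with provisos (`populated_v1GObjects`). [bookkeeping] -/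
theorem populated_readingOfRecord₁₃CoPH_of_v1G (hL : 1 ≤ L) (F : T4Family) (θ : Stage13HParams F N) (hP : θ.Provisos₁₃CoPH F N) (g₀ : ℕ → ℝ)
    (os : List (ULoop F))
    (h : ∀ k : ℕ, ∃ (c35 p : ℝ)
        (Ksite Kunit : ∀ j : VecIndexS d L, B9.SiteKernel (v1GVecInstance (d := d) 𝔄 ι L hL j).gc (v1GVecInstance (d := d) 𝔄 ι L hL j).Bf)
        (inΛ : ∀ j : VecIndexS d L, (v1GVecInstance (d := d) 𝔄 ι L hL j).gc.Site → Prop)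
        (unitDist : ∀ j : VecIndexS d L, (v1GVecInstance (d := d) 𝔄 ι L hL j).gc.Site → (v1GVecInstance (d := d) 𝔄 ι L hL j).gc.Site → ℝ),
        ne2 F θ g₀ os k =
          { I := VecIndexS d L, c35 := c35, p := p, pi := v1GVecInstance (d := d) 𝔄 ι L hL, Kop := v1GVecFamily4 (d := d) 𝔄 ι e L hL,
            Ksite := Ksite, Kunit := Kunit, inΛ := inΛ, unitDist := unitDist }) :
    ((readingOfRecord₁₃CoPH w1 ℓ₃ ne2 ne1).lit F θ hP g₀ os).Populated := by
  refine (readingOfRecord₁₃CoPH_populated_iff w1 ℓ₃ ne2 ne1 F θ hP g₀ os).2 fun k => ?_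
  obtain ⟨c35, p, Ksite, Kunit, inΛ, unitDist, hk⟩ := h k
  rw [hk]
  exact populated_v1GObjects e hL c35 p Ksite Kunit inΛ unitDist

end Gauge

end Summit.QuantumFields.YangMills.BalabanUVNodes.N15.AtReadingOfRecord13CoPH

end
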